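import Summits.MatrixMultiplication.OmegaCensus.DihedralLawModOneRankThreeExamples
import Summits.MatrixMultiplication.OmegaCensus.CubeLawParityModEight
import HarnessLib

/-!
# The `|A| ≡ 1 (mod 3)` law over `A` with `dim A/2A ≥ 3`, mod-8 version: `|A| = 232`

ω-census, family (b3).  Framing: lottery ticket; floor = certified bounds/negative ranges.

`DihedralLawModOneRankThree.lean` with the sharper cube-part criterion of `CubeLawParityModEight.lean`: over `A` with
three homomorphisms to `ZMod 2` jointly onto `𝔽₂³`, a law-attaining cube triple has all coset parts `≡ ±1 (mod 8)`.
Hence if every factorisation `cde = (|A| − 1)/3` has two parts `1` or a part `≢ ±1 (mod 8)`, every law triple forces an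
element of order `≥ |A|/2` (`card_le_two_mul_addOrderOf_of_law_rank_three'`).  New order covered: `|A| = 232`
(`cde = 77`: `(1,7,11)` has `11 ≡ 3`), i.e. `ℤ₂³ × ℤ₂₉` — the only abelian group of order `232` without a cyclic
subgroup of index `≤ 2` — carries no law triple (`no_law_card_232_of_rank_three`, `no_law_Z2_Z2_Z2_Z29`); the
classification 'law ⟹ element of order `≥ |A|/2`' holds at `|A| = 232`.
-/

namespace Summit.MatrixMultiplication.OmegaCensus

open Literature.Combinatorics.Additive Finset

section Arith

/-- `cde = 77`: two parts `1`, or a part `≢ ±1 (mod 8)`. [folklore] -/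
theorem cube_factor_mod_eight_232 {c d e : ℕ} (h : 3 * (c * d * e) + 1 = 232) :
    (c = 1 ∧ d = 1) ∨ (d = 1 ∧ e = 1) ∨ (c = 1 ∧ e = 1) ∨ (c % 8 ≠ 1 ∧ c % 8 ≠ 7) ∨ (d % 8 ≠ 1 ∧ d % 8 ≠ 7) ∨
      (e % 8 ≠ 1 ∧ e % 8 ≠ 7) := by
  have hq : c * d * e = 77 := by omega
  have hc : c ∣ 77 := ⟨d * e, by rw [← hq]; ring⟩
  have hd : d ∣ 77 := ⟨c * e, by rw [← hq]; ring⟩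
  have hc' : c ≤ 77 := Nat.le_of_dvd (by norm_num) hc
  have hd' : d ≤ 77 := Nat.le_of_dvd (by norm_num) hd
  -- divisors of `77` are `1, 7, 11, 77`
  have hcv : c = 1 ∨ c = 7 ∨ c = 11 ∨ c = 77 := by
    interval_cases c <;> omega
  have hdv : d = 1 ∨ d = 7 ∨ d = 11 ∨ d = 77 := by
    interval_cases d <;> omega
  rcases hcv with rfl | rfl | rfl | rfl <;> rcases hdv with rfl | rfl | rfl | rfl <;> omega

end Arith

section DihedralLike

variable {A : Type*} [AddCommGroup A] [DecidableEq A] [Fintype A] {G : Type} [Group G] [DecidableEq G]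
  {ρ τ : A → G} {c₀ : A} {S T U : Finset G}

/-- **Rank three, mod-8 version: every law triple forces an element of order `≥ |A|/2`,** provided every
factorisation `cde = (|A| − 1)/3` has two parts `1` or a part `≢ ±1 (mod 8)`. [folklore] -/
theorem card_le_two_mul_addOrderOf_of_law_rank_three'
    (hρρ : ∀ a b, ρ a * ρ b = ρ (a + b)) (hρτ : ∀ a b, ρ a * τ b = τ (b - a))
    (hτρ : ∀ a b, τ a * ρ b = τ (a + b)) (hττ : ∀ a b, τ a * τ b = ρ (c₀ + b - a))
    (hρ : Function.Injective ρ) (hτ : Function.Injective τ) (hne : ∀ a b, ρ a ≠ τ b)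
    (hsurj : ∀ g, (∃ a, ρ a = g) ∨ (∃ a, τ a = g)) (hA : 14 ≤ Fintype.card A)
    (ψ₁ ψ₂ ψ₃ : A →+ ZMod 2) (hψ : ∀ v : ZMod 2 × ZMod 2 × ZMod 2, ∃ a, (ψ₁ a, ψ₂ a, ψ₃ a) = v)
    (hq : ∀ c d e : ℕ, 3 * (c * d * e) + 1 = Fintype.card A →
      (c = 1 ∧ d = 1) ∨ (d = 1 ∧ e = 1) ∨ (c = 1 ∧ e = 1) ∨ (c % 8 ≠ 1 ∧ c % 8 ≠ 7) ∨
        (d % 8 ≠ 1 ∧ d % 8 ≠ 7) ∨ (e % 8 ≠ 1 ∧ e % 8 ≠ 7))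
    (h : TripleProductProperty S T U) (hV : 3 * (S.card * T.card * U.card) + 8 = 8 * Fintype.card A) :
    ∃ g : A, Fintype.card A ≤ 2 * addOrderOf g := by
  have hmod : Fintype.card A % 3 = 1 := by omega
  have hA7 : 7 ≤ Fintype.card A := by omega
  have hV_TUS : 3 * (T.card * U.card * S.card) + 8 = 8 * Fintype.card A := by
    rw [show T.card * U.card * S.card = S.card * T.card * U.card by ring]; exact hV
  have hV_UST : 3 * (U.card * S.card * T.card) + 8 = 8 * Fintype.card A := by
    rw [show U.card * S.card * T.card = S.card * T.card * U.card by ring]; exact hV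
  have hTUS : TripleProductProperty T U S := h.rotate
  have hUST : TripleProductProperty U S T := h.rotate.rotate
  by_cases hnc : ((univ.filter fun a : A => ρ a ∈ S).card = (univ.filter fun a : A => τ a ∈ S).card ∧
      (univ.filter fun a : A => ρ a ∈ T).card = (univ.filter fun a : A => τ a ∈ T).card ∧
      (univ.filter fun a : A => ρ a ∈ U).card = (univ.filter fun a : A => τ a ∈ U).card)
  · obtain ⟨hS', hT', hU'⟩ := hnc
    have cS := card_eq_parts' hρ hτ hne hsurj S
    have cT := card_eq_parts' hρ hτ hne hsurj T
    have cU := card_eq_parts' hρ hτ hne hsurj U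
    set s₀ := (univ.filter fun a : A => ρ a ∈ S).card with hs₀
    set t₀ := (univ.filter fun a : A => ρ a ∈ T).card with ht₀
    set u₀ := (univ.filter fun a : A => ρ a ∈ U).card with hu₀
    have eS : S.card = 2 * s₀ := by rw [cS, ← hS']; ring
    have eT : T.card = 2 * t₀ := by rw [cT, ← hT']; ring
    have eU : U.card = 2 * u₀ := by rw [cU, ← hU']; ring
    have hprod : 3 * (s₀ * t₀ * u₀) + 1 = Fintype.card A := by
      rw [eS, eT, eU] at hV; nlinarith
    rcases hq s₀ t₀ u₀ hprod with ⟨h1, h1'⟩ | ⟨h1, h1'⟩ | ⟨h1, h1'⟩ | hc | hd | he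
    · exact card_le_two_mul_addOrderOf_of_two_two_law hρρ hρτ hτρ hττ hρ hτ hne hsurj hmod hA7 h
        (by rw [eS, h1]) (by rw [eT, h1']) hV
    · exact card_le_two_mul_addOrderOf_of_two_two_law hρρ hρτ hτρ hττ hρ hτ hne hsurj hmod hA7 hTUS
        (by rw [eT, h1]) (by rw [eU, h1']) hV_TUS
    · exact card_le_two_mul_addOrderOf_of_two_two_law hρρ hρτ hτρ hττ hρ hτ hne hsurj hmod hA7 hUST
        (by rw [eU, h1']) (by rw [eS, h1]) hV_UST
    · have := cube_part_mod_eight_left hρρ hρτ hτρ hττ hρ hτ hne hsurj ψ₁ ψ₂ ψ₃ hψ h hS' hT' hU' hV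
      exact (hc.elim (fun h1 h2 => this.elim h1 h2)).elim
    · have := cube_part_mod_eight hρρ hρτ hτρ hττ hρ hτ hne hsurj ψ₁ ψ₂ ψ₃ hψ h hS' hT' hU' hV
      exact (hd.elim (fun h1 h2 => this.elim h1 h2)).elim
    · have := cube_part_mod_eight_right hρρ hρτ hτρ hττ hρ hτ hne hsurj ψ₁ ψ₂ ψ₃ hψ h hS' hT' hU' hV
      exact (he.elim (fun h1 h2 => this.elim h1 h2)).elim
  · obtain ⟨g, a, b, hab⟩ :=
      two_cosets_of_mod_one_law_of_not_cube hρρ hρτ hτρ hττ hρ hτ hne hsurj hmod hA h hV hnc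
    exact ⟨g, card_le_two_mul_addOrderOf_of_two_cosets hab⟩

/-- **`|A| = 232`, `dim A/2A ≥ 3`, all element orders `< 116` (`ℤ₂³ × ℤ₂₉`): no law.** [folklore] -/
theorem no_law_card_232_of_rank_three
    (hρρ : ∀ a b, ρ a * ρ b = ρ (a + b)) (hρτ : ∀ a b, ρ a * τ b = τ (b - a))
    (hτρ : ∀ a b, τ a * ρ b = τ (a + b)) (hττ : ∀ a b, τ a * τ b = ρ (c₀ + b - a))
    (hρ : Function.Injective ρ) (hτ : Function.Injective τ) (hne : ∀ a b, ρ a ≠ τ b)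
    (hsurj : ∀ g, (∃ a, ρ a = g) ∨ (∃ a, τ a = g)) (hA : Fintype.card A = 232)
    (ψ₁ ψ₂ ψ₃ : A →+ ZMod 2) (hψ : ∀ v : ZMod 2 × ZMod 2 × ZMod 2, ∃ a, (ψ₁ a, ψ₂ a, ψ₃ a) = v)
    (hord : ∀ g : A, 2 * addOrderOf g < Fintype.card A) (h : TripleProductProperty S T U) :
    3 * (S.card * T.card * U.card) + 8 ≠ 8 * Fintype.card A := by
  intro hV
  obtain ⟨g, hg⟩ := card_le_two_mul_addOrderOf_of_law_rank_three' hρρ hρτ hτρ hττ hρ hτ hne hsurj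
    (by rw [hA]; norm_num) ψ₁ ψ₂ ψ₃ hψ (fun c d e hcde => cube_factor_mod_eight_232 (by rw [hcde, hA])) h hV
  exact absurd (hord g) (not_lt.2 hg)

/-- **`ℤ₂³×ℤ₂₉`** (`|A| = 232`): no dihedral-like group over `ZMod 2 × ZMod 2 × ZMod 2 × ZMod 29` attains the law.
[folklore] -/
theorem no_law_Z2_Z2_Z2_Z29 {ρ τ : ZMod 2 × ZMod 2 × ZMod 2 × ZMod 29 → G}
    {c₀ : ZMod 2 × ZMod 2 × ZMod 2 × ZMod 29} {S T U : Finset G}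
    (hρρ : ∀ a b, ρ a * ρ b = ρ (a + b)) (hρτ : ∀ a b, ρ a * τ b = τ (b - a))
    (hτρ : ∀ a b, τ a * ρ b = τ (a + b)) (hττ : ∀ a b, τ a * τ b = ρ (c₀ + b - a))
    (hρ : Function.Injective ρ) (hτ : Function.Injective τ) (hne : ∀ a b, ρ a ≠ τ b)
    (hsurj : ∀ g, (∃ a, ρ a = g) ∨ (∃ a, τ a = g)) (h : TripleProductProperty S T U) :
    3 * (S.card * T.card * U.card) + 8 ≠ 8 * Fintype.card (ZMod 2 × ZMod 2 × ZMod 2 × ZMod 29) := by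
  have hc : Fintype.card (ZMod 2 × ZMod 2 × ZMod 2 × ZMod 29) = 232 := by simp [Fintype.card_prod, ZMod.card]
  refine no_law_card_232_of_rank_three hρρ hρτ hτρ hττ hρ hτ hne hsurj hc _ _ _
    (jointlyOnto_prod₃_prod (RingHom.id (ZMod 2)) (RingHom.id (ZMod 2)) (RingHom.id (ZMod 2)))
    (two_mul_addOrderOf_lt_of_nsmul_eq_zero 58 (by norm_num)
      (by rintro ⟨a, b, c, x⟩
          simp only [Prod.smul_mk, Prod.mk_eq_zero]
          exact ⟨zmod_nsmul_eq_zero (by norm_num) a, zmod_nsmul_eq_zero (by norm_num) b,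
            zmod_nsmul_eq_zero (by norm_num) c, zmod_nsmul_eq_zero (by norm_num) x⟩)
      (by rw [hc]; norm_num)) h

end DihedralLike

end Summit.MatrixMultiplication.OmegaCensus
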